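import Mathlib
import HarnessLib

/-!
# Periodic-skeleton identities (Floquet form of R12′): frozen-in time-periodic vorticity at a
# hyperbolic periodic point, and invariance of the stable set under commuting maps

HONEST FRAMING (cell `ns-blowup`, seat `ns-blowup-instab`, human ruling D-0035): nothing here is a
claim about Navier–Stokes blow-up. WHAT THIS IS NOT: not a statement about the marginal tower N1*;
it is the abstract linear algebra / topological dynamics behind the TIME-PERIODIC extension of the
stagnation-point identities R12′ (`StagnationPointIdentities`: S1 `Ω(x₀) = 0` at a non-degenerate
stagnation point of a steady inviscid flow; S3 stable/unstable manifolds are vortex surfaces),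
used in `instab/X1pp-SKENE-TOBIAS.md` §3 to type the crux X1″ («unsteady host») for hosts whose
vorticity is FROZEN IN and TIME-PERIODIC (exact time-periodic Euler flows, potential forcing):

* (F-S1) Let `P` be the period map of the flow and `Ω` the time-`0` vorticity. Frozen-in transport
  over one period plus periodicity of the vorticity field give `P_* Ω = Ω`, i.e. pointwise
  `DP(x) Ω(x) = Ω(P x)`. At a fixed point `x₀ = P x₀` this says `DP(x₀) Ω(x₀) = Ω(x₀)`; if `x₀` is
  HYPERBOLIC (`1` is not an eigenvalue of `DP(x₀)`), then `Ω(x₀) = 0`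
  (`eq_zero_of_periodMap_invariant`). The steady case S1 is the infinitesimal version.
* (F-S3) If a map `φ` commutes with `P` and fixes `x₀`, then `φ` maps the stable set
  `W^s(x₀) = {x | Pⁿ x → x₀}` into itself (`mapsTo_stableSet_of_commute`; unstable set: `mapsTo_unstableSet_of_commute`); applied to the flow
  `φ = φ^Ω_s` of the invariant field `Ω` (which commutes with `P` because `P_* Ω = Ω`, and fixes `x₀`
  by F-S1) for every `s`, this is «`W^s(x₀)` is invariant under the vorticity flow», i.e. `Ω` is
  tangent to the stable manifold: the time-`0` fibre of the stable manifold of a hyperbolic periodic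
  point of a time-periodic Euler flow is a VORTEX SURFACE, and so is every other fibre (transport).
  With `P` replaced by `P⁻¹` the same lemma gives the unstable set.

Consequence recorded in the memo (EXACT at ε = 0): in the S5 flux ledger (RATE-AUDIT 6.6.5) a
time-periodic host with frozen-in vorticity delivers NO host flux to its own hyperbolic skeleton —
the only DC channel about such a host is a non-decaying Floquet direction with non-zero
period-averaged disc flux (X0-Floquet), exactly as for steady hosts. Hosts whose time dependence is
maintained by a NON-potential force (e.g. the rigidly «wobbling» ABC flow of Brummell–Cattaneo–Tobias
2001 / Skene–Tobias 2023, `WobblingBeltramiHost`) are not frozen-in and are treated separately.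

All statements are over abstract (normed) spaces / topological spaces; the fluid content is the
docstrings' dictionary. References: V. I. Arnold, *Ann. Inst. Fourier* 16 (1966) (steady case);
T. Kambe, *Geometrical Theory of Dynamical Systems and Fluid Flows*, §8.8.1; cell files
`instab/RATE-AUDIT.md` §6.6, `instab/X1pp-SKENE-TOBIAS.md` §3.
-/

namespace Summit.NavierStokesRegularity.FluidComputer.PeriodicSkeletonIdentities

open Filter Function Set
open scoped Topology

section Linear

variable {E : Type*} [NormedAddCommGroup E] [NormedSpace ℝ E]

/-- **(F-S1) A period-map-invariant vector field vanishes at a hyperbolic fixed point.**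
If `P x₀ = x₀`, the field `Ω` is invariant under `P` at `x₀` in the pointwise sense
`DP(x₀) (Ω x₀) = Ω (P x₀)` (frozen-in transport over one period + time-periodicity of the
vorticity), and `1` is not an eigenvalue of `DP(x₀)` (hyperbolicity: `DP(x₀) w = w → w = 0`),
then `Ω x₀ = 0`. -/
theorem eq_zero_of_periodMap_invariant {P Ω : E → E} {x₀ : E} (hfix : P x₀ = x₀)
    (hinv : fderiv ℝ P x₀ (Ω x₀) = Ω (P x₀))
    (hhyp : ∀ w : E, fderiv ℝ P x₀ w = w → w = 0) : Ω x₀ = 0 :=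
  hhyp (Ω x₀) (by rw [hinv, hfix])

/-- The same with the linearised period map given abstractly as a continuous linear map `M`
(`M = DP(x₀)`, the monodromy of the periodic point) whose fixed space is trivial. -/
theorem eq_zero_of_monodromy_fixed {M : E →L[ℝ] E} {v : E} (hv : M v = v)
    (hhyp : ∀ w : E, M w = w → w = 0) : v = 0 :=
  hhyp v hv

/-- Hyperbolicity in the usual form implies the hypothesis used above: if `M - 1` is injective
(no eigenvalue `1`), then `M w = w → w = 0`. -/
theorem fixed_eq_zero_of_injective_sub_one {M : E →L[ℝ] E}
    (hinj : Function.Injective (M - 1 : E →L[ℝ] E)) (w : E) (hw : M w = w) : w = 0 := by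
  apply hinj
  simp [hw]

/-- Infinitesimal (steady) version recovered: if `A = DU(x₀)` is injective and `A (Ω x₀) = 0`
(the steady balance `DU(x₀)Ω(x₀) = DΩ(x₀)U(x₀) = 0` at a stagnation point), then `Ω x₀ = 0` —
`StagnationPointIdentities.eq_zero_of_steady_inviscid` is the fluid-vocabulary form; recorded here
only to display F-S1 as its time-periodic analogue (`M = exp(T·A)` has no eigenvalue `1` iff `A`
has no eigenvalue in `2πiℤ/T`, in particular when `A` is hyperbolic). -/
theorem eq_zero_of_injective_apply_eq_zero {A : E →L[ℝ] E} {v : E}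
    (hinj : Function.Injective A) (hv : A v = 0) : v = 0 :=
  hinj (by rw [hv, map_zero])

end Linear

section StableSet

variable {X : Type*} [TopologicalSpace X]

/-! The stable set of a point `x₀` under iteration of a map `P` is written inline as
`{x | Tendsto (fun n : ℕ => P^[n] x) atTop (𝓝 x₀)}`; for the period map of a time-periodic flow and
a hyperbolic periodic point this is (the time-`0` fibre of) the stable manifold. -/

/-- The base point of a fixed point belongs to its own stable set. -/
theorem self_mem_stableSet {P : X → X} {x₀ : X} (hfix : P x₀ = x₀) :
    x₀ ∈ {x | Tendsto (fun n : ℕ => P^[n] x) atTop (𝓝 x₀)} := by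
  rw [mem_setOf_eq]
  have : (fun n : ℕ => P^[n] x₀) = fun _ => x₀ :=
    funext fun n => Function.iterate_fixed hfix n
  rw [this]
  exact tendsto_const_nhds

/-- The stable set is forward invariant under `P` itself. -/
theorem mapsTo_stableSet_self {P : X → X} {x₀ : X} :
    MapsTo P {x | Tendsto (fun n : ℕ => P^[n] x) atTop (𝓝 x₀)}
      {x | Tendsto (fun n : ℕ => P^[n] x) atTop (𝓝 x₀)} := by
  intro x hx
  rw [mem_setOf_eq] at hx ⊢
  have h : (fun n : ℕ => P^[n] (P x)) = fun n => P^[n + 1] x :=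
    funext fun n => (Function.iterate_succ_apply P n x).symm
  rw [h]
  exact hx.comp (tendsto_add_atTop_nat 1)

/-- **(F-S3) A continuous map commuting with `P` and fixing `x₀` preserves the stable set of `x₀`.**
Proof: `Pⁿ (φ x) = φ (Pⁿ x) → φ x₀ = x₀`. Applied to every time-`s` map `φ = φ^Ω_s` of the flow of a
`P`-invariant vector field `Ω` vanishing at `x₀` (F-S1), it says that `W^s(x₀)` is invariant under
the flow of `Ω`, i.e. `Ω` is tangent to the stable manifold — the stable manifold of a hyperbolic
periodic point of a time-periodic flow with frozen-in periodic vorticity is a vortex surface. -/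
theorem mapsTo_stableSet_of_commute {P φ : X → X} {x₀ : X} (hcomm : Function.Commute φ P)
    (hφ : Continuous φ) (hfix : φ x₀ = x₀) :
    MapsTo φ {x | Tendsto (fun n : ℕ => P^[n] x) atTop (𝓝 x₀)}
      {x | Tendsto (fun n : ℕ => P^[n] x) atTop (𝓝 x₀)} := by
  intro x hx
  rw [mem_setOf_eq] at hx ⊢
  have h' : ∀ n : ℕ, P^[n] (φ x) = φ (P^[n] x) := fun n => by
    have := Function.Commute.iterate_right hcomm n
    exact (this x).symm
  rw [show (fun n : ℕ => P^[n] (φ x)) = fun n => φ (P^[n] x) from funext h']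
  have hc : Tendsto φ (𝓝 x₀) (𝓝 (φ x₀)) := hφ.continuousAt
  rw [hfix] at hc
  exact hc.comp hx

/-- The image formulation: `φ '' W^s(x₀) ⊆ W^s(x₀)`. -/
theorem image_stableSet_subset_of_commute {P φ : X → X} {x₀ : X} (hcomm : Function.Commute φ P)
    (hφ : Continuous φ) (hfix : φ x₀ = x₀) :
    φ '' {x | Tendsto (fun n : ℕ => P^[n] x) atTop (𝓝 x₀)} ⊆
      {x | Tendsto (fun n : ℕ => P^[n] x) atTop (𝓝 x₀)} :=
  (mapsTo_stableSet_of_commute hcomm hφ hfix).image_subset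

/-- If moreover `φ` is a homeomorphism commuting with `P` (as every time-`s` map of a complete flow
commuting with `P` is, with inverse the time-`(−s)` map), the stable set is exactly invariant:
`φ '' W^s(x₀) = W^s(x₀)`. -/
theorem image_stableSet_eq_of_commute {P : X → X} (φ : X ≃ₜ X) {x₀ : X}
    (hcomm : Function.Commute φ P) (hfix : φ x₀ = x₀) :
    φ '' {x | Tendsto (fun n : ℕ => P^[n] x) atTop (𝓝 x₀)} =
      {x | Tendsto (fun n : ℕ => P^[n] x) atTop (𝓝 x₀)} := by
  have hcomm' : Function.Commute φ.symm P := by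
    intro x
    apply φ.injective
    rw [φ.apply_symm_apply, hcomm (φ.symm x), φ.apply_symm_apply]
  have hfix' : φ.symm x₀ = x₀ := by
    rw [Homeomorph.symm_apply_eq, hfix]
  refine Subset.antisymm (image_stableSet_subset_of_commute hcomm φ.continuous hfix) ?_
  intro x hx
  refine ⟨φ.symm x, mapsTo_stableSet_of_commute hcomm' φ.symm.continuous hfix' hx, ?_⟩
  exact φ.apply_symm_apply x

/-- **Unstable set.** For an invertible period map (a homeomorphism `P`), the unstable set of `x₀` is
the stable set of `P⁻¹`; a map commuting with `P` commutes with `P⁻¹`, so F-S3 applies verbatim: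
the unstable manifold is a vortex surface too. -/
theorem mapsTo_unstableSet_of_commute (P : X ≃ₜ X) {φ : X → X} {x₀ : X}
    (hcomm : Function.Commute φ P) (hφ : Continuous φ) (hfix : φ x₀ = x₀) :
    MapsTo φ {x | Tendsto (fun n : ℕ => P.symm^[n] x) atTop (𝓝 x₀)}
      {x | Tendsto (fun n : ℕ => P.symm^[n] x) atTop (𝓝 x₀)} := by
  have hcomm' : Function.Commute φ P.symm := by
    intro x
    apply P.injective
    rw [P.apply_symm_apply, ← hcomm (P.symm x), P.apply_symm_apply]
  exact mapsTo_stableSet_of_commute hcomm' hφ hfix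

end StableSet

end Summit.NavierStokesRegularity.FluidComputer.PeriodicSkeletonIdentities
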